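import Summits.HodgeConjecture.HodgeConjecture.Theses.CurveNetMordellWeil
import Literature.AlgebraicGeometry.HodgeTheory.SupportedHodgeClassesAlgebraic
import Literature.AlgebraicTopology.SingularHomology.GysinMapSupportProofs

/-!
# Route CurveNetMordellWeil — `GysinPreservesAlgebraic` (item stmt-HodgeConjecture-2787)

The support item `GysinPreservesAlgebraic` of the route `CurveNetMordellWeil`: for a morphism
`g : W ⟶ X` of smooth projective complex varieties with `dim W = m`, `dim X = n = m + e`, the
complex Gysin map `g_*` (for any orientation family `μ` with Poincaré duality) carries
`Nᵈ H²ᵈ(W(ℂ); ℂ) = algebraicClasses W d` into `N^{d+e} H^{2d+2e}(X(ℂ); ℂ) = algebraicClasses X (d+e)`.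

Proof: this is exactly the Literature theorem
`Literature.AlgebraicGeometry.HodgeTheory.map_complexGysin_algebraicClasses_le`
(`SupportedHodgeClassesAlgebraic.lean`: push the supporting closed subset forward — `g` is proper,
images do not raise dimension, and a class dying off `S` has Gysin image dying off `g(S)` by the
Borel–Moore base-change / support property of Gysin maps), fed with the PROVED support property of
Gysin maps over a field,
`Literature.AlgebraicTopology.SingularHomology.gysinMap_restrictCompl_eq_zero_of_field ℂ`
(`GysinMapSupportProofs.lean`, Fulton, *Young Tableaux*, App. B §B.2 Ex. 5).  Unconditional.
-/

noncomputable section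

-- mandated namespace `Summit.HodgeConjecture.HodgeConjecture.Theorems` (single-problem summit: Problem =
-- Summit) trips `linter.dupNamespace`; off tree-wide in the lakefile, restated for stand-alone elaboration.
set_option linter.dupNamespace false

open CategoryTheory AlgebraicGeometry
open Literature.AlgebraicGeometry Literature.AlgebraicGeometry.HodgeTheory
open Literature.AlgebraicTopology.SingularHomology

namespace Summit.HodgeConjecture.HodgeConjecture.Theorems

/-- **Item stmt-HodgeConjecture-2787 (`GysinPreservesAlgebraic`)**: Gysin images of algebraic
classes are algebraic, with the codimension shift — for `g : W ⟶ X` of smooth projective complex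
varieties, `dim W = m`, `dim X = n = m + e`, and every orientation family `μ` with Poincaré
duality, `g_*(algebraicClasses W d) ≤ algebraicClasses X (d + e)`.  The type is literally the
route decl `Summit.HodgeConjecture.HodgeConjecture.Theses.CurveNetMordellWeil.GysinPreservesAlgebraic`;
the proof is `map_complexGysin_algebraicClasses_le` applied to the proved support property
`gysinMap_restrictCompl_eq_zero_of_field ℂ`.
[cite: FultonYoungTableaux1997, Appendix B §B.2 Exercise 5] -/
theorem curveNetMordellWeil_gysinPreservesAlgebraic_proof :
    Summit.HodgeConjecture.HodgeConjecture.Theses.CurveNetMordellWeil.GysinPreservesAlgebraic := by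
  unfold Summit.HodgeConjecture.HodgeConjecture.Theses.CurveNetMordellWeil.GysinPreservesAlgebraic
  intro μ hμ m n d e W X hW hX g hm
  exact map_complexGysin_algebraicClasses_le (gysinMap_restrictCompl_eq_zero_of_field ℂ) μ hμ hW hX
    g hm

end Summit.HodgeConjecture.HodgeConjecture.Theorems

end
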